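import Summits.AtomisticToContinuum.BoseEinsteinCondensation.Theorems.BECConjugateDominationHardCoreExtensionAlphaPhysCutState
import Summits.AtomisticToContinuum.BoseEinsteinCondensation.Theorems.BECConjugateDominationHardCoreExtensionAlphaPhysBookkeeping
import Summits.AtomisticToContinuum.BoseEinsteinCondensation.Theorems.BECConjugateDominationHardCoreExtensionBoundedPositiveMinimiserHolds
import Summits.AtomisticToContinuum.BoseEinsteinCondensation.Theorems.BECConjugateDominationHardCoreExtensionGradientCauchy
import HarnessLib

/-!
# (α'_phys) part 4/4: energy convergence `E₀(min(v,n)) ↑ E₀(v)` for HARD CORE + BOUNDED TAIL, from the three analytic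
# nodes E2 (pair cut-off), P3 (kinetic tightness of truncation minimisers), P4 (pair-shell mass bound)
# — line `third-law-current-floor`, crux `HardCoreExtension` (stmt-AtomisticToContinuum-11786), lead c1

The registered implication stub `stub_truncationEnergyConvergencePhys_of`: (E2) → (P3) → (P4) → for every admissible `v` with
`v = ⊤` on `[0,a]` (`a > 0`) and `v ≤ M < ⊤` on `(a, ∞)`, every `N` and `L > 4a` with `E₀(v,N,L) < ⊤`:
`∀ ε > 0, ∃ n₀, ∀ n ≥ n₀, E₀(v) ≤ E₀(min(v,n)) + ε`. The competitor for `E₀(v)` is the cut state `χ_ℓ · Ψₘ` of a positive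
minimiser `Ψₘ` of a high truncation (they exist for every bounded admissible potential: `boundedPositiveMinimiser_holds`),
normalised; its energy is controlled by the multiplier bound (IMS/Young), the cut-off's gradient bound `≤ C/ℓ²` on the outer
shell (E2), the shell mass bound (P4: `≤ C·(core mass) + Cℓ²·(layer kinetic energy)`), the core mass `≤ E₀(v)/m` of the
penalised minimiser, and the smallness of the layer kinetic energy along a Rellich subsequence (P3). No form-core theorem, no
trace theorem and no capacity theory enter. [folklore; the Lean route is new]
-/

noncomputable section

namespace Summit.AtomisticToContinuum.BoseEinsteinCondensation.Cruxes.HardCoreExtension.ThirdLawCurrentFloor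

open MeasureTheory Filter
open scoped ENNReal NNReal BigOperators Topology
open Literature.MathematicalPhysics.QuantumManyBody.BoseGas
open Summit.AtomisticToContinuum.BoseEinsteinCondensation.Theorems.PositiveMinimiser

namespace AlphaPhys

variable {N : ℕ} {L : ℝ}

/-! ### More helpers for the assembly -/

/-- For `N = 0` particles there are no pairs: the periodic energy does not depend on the potential. [folklore] -/
theorem periodicGroundStateEnergy_congr_of_isEmpty (v w : ℝ → ℝ≥0∞) (L : ℝ) :
    periodicGroundStateEnergy v 0 L = periodicGroundStateEnergy w 0 L := by
  have h : ∀ (u : ℝ → ℝ≥0∞) (X : Config 0), periodicInteraction u L X = 0 := fun u X => by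
    simp [periodicInteraction]
  unfold periodicGroundStateEnergy periodicEnergy
  simp_rw [h]

/-- Truncations of an admissible potential are admissible. [folklore] -/
theorem isRepulsiveFiniteRange_min {v : ℝ → ℝ≥0∞} (hv : IsRepulsiveFiniteRange v) (n : ℕ) :
    IsRepulsiveFiniteRange (fun r => min (v r) (n : ℝ≥0∞)) := by
  refine ⟨hv.1.min measurable_const, ?_⟩
  obtain ⟨R₀, hR₀⟩ := hv.2
  exact ⟨R₀, fun r hr => by simp [hR₀ r hr]⟩

/-- Truncations are bounded. [folklore] -/
theorem min_bounded (v : ℝ → ℝ≥0∞) (n : ℕ) :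
    ∃ M : ℝ≥0∞, M ≠ ⊤ ∧ ∀ r, min (v r) (n : ℝ≥0∞) ≤ M :=
  ⟨n, ENNReal.natCast_ne_top n, fun _ => min_le_right _ _⟩

/-! ### The assembly -/

/-- **(α'_phys) from the four inputs** (pair cut-off E2, kinetic tightness P3, shell mass P4, positive minimisers of the
bounded class): for an admissible `v` with `v = ⊤` on `[0,a)` and `v ≤ M < ⊤` on `(a,∞)` (nothing is asked at `r = a`:
`hardCorePotential a` and its closed-core variant both qualify), every `N`, every `L > 4a` with
`E₀(v, N, L) < ⊤`, and every `ε > 0`, all high truncations satisfy `E₀(v) ≤ E₀(min(v,n)) + ε`. [folklore] -/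
theorem alphaPhys_of
    (hcut : ∀ (N : ℕ) (L a : ℝ), 0 < L → 0 < a → ∃ C : ℝ, 0 ≤ C ∧ ∀ ℓ : ℝ, 0 < ℓ → ℓ ≤ a →
      ∃ χ : Config N → ℝ, ContDiff ℝ 1 χ ∧
        (∀ (X : Config N) (i : Fin N) (k : Fin 3),
          χ (X + Pi.single i (EuclideanSpace.single k L)) = χ X) ∧
        (∀ (σ : Equiv.Perm (Fin N)) (X : Config N), χ (X ∘ σ) = χ X) ∧
        (∀ X, 0 ≤ χ X ∧ χ X ≤ 1) ∧
        (∀ X : Config N, (∃ i j : Fin N, i ≠ j ∧ ∃ n : Fin 3 → ℤ, ‖X i - X j - latticeVec L n‖ ≤ a) →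
          χ X = 0) ∧
        (∀ X : Config N, (∀ i j : Fin N, i ≠ j → ∀ n : Fin 3 → ℤ, a + ℓ ≤ ‖X i - X j - latticeVec L n‖) →
          χ X = 1) ∧
        (∀ X : Config N, kineticDensity (fun Y => (χ Y : ℂ)) X ≤ ENNReal.ofReal (C / ℓ ^ 2)) ∧
        (∀ X : Config N, (∀ i j : Fin N, i ≠ j → ∀ n : Fin 3 → ℤ,
            ‖X i - X j - latticeVec L n‖ ≤ a ∨ a + ℓ ≤ ‖X i - X j - latticeVec L n‖) →
          kineticDensity (fun Y => (χ Y : ℂ)) X = 0))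
    (htight : ∀ (v : ℝ → ℝ≥0∞), Measurable v → ∀ (N : ℕ) (L : ℝ), 0 < L → ∀ B : ℝ≥0∞, B ≠ ⊤ →
      ∀ Ψ : ℕ → PeriodicTrialState N L,
        (∀ n : ℕ, periodicEnergy (fun r => min (v r) (n : ℝ≥0∞)) (Ψ n) =
          periodicGroundStateEnergy (fun r => min (v r) (n : ℝ≥0∞)) N L) →
        (∀ n : ℕ, periodicEnergy (fun r => min (v r) (n : ℝ≥0∞)) (Ψ n) ≤ B) →
        ∃ φ : ℕ → ℕ, StrictMono φ ∧
          ∀ S : ℕ → Set (Config N), (∀ k, MeasurableSet (S k)) → Antitone S →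
            volume ((⋂ k, S k) ∩ cellN N L) = 0 →
            ∀ ε : ℝ, 0 < ε → ∃ k₀ i₀ : ℕ, ∀ k i : ℕ, k₀ ≤ k → i₀ ≤ i →
              ∫⁻ X in S k ∩ cellN N L, kineticDensity (Ψ (φ i)).ψ X ≤ ENNReal.ofReal ε)
    (hshell : ∀ (N : ℕ) (L a : ℝ), 0 < L → 0 < a → 4 * a < L → ∃ C : ℝ, 0 ≤ C ∧ ∀ ℓ : ℝ, 0 < ℓ → ℓ ≤ a →
      ∀ Ψ : Config N → ℂ, ContDiff ℝ 1 Ψ →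
        (∀ (X : Config N) (i : Fin N) (k : Fin 3), Ψ (X + Pi.single i (EuclideanSpace.single k L)) = Ψ X) →
        ∫⁻ X in {X : Config N | ∃ i j : Fin N, i ≠ j ∧ ∃ n : Fin 3 → ℤ,
            a < ‖X i - X j - latticeVec L n‖ ∧ ‖X i - X j - latticeVec L n‖ < a + ℓ} ∩ cellN N L,
            (‖Ψ X‖₊ : ℝ≥0∞) ^ 2 ≤
          ENNReal.ofReal C *
              (∫⁻ X in {X : Config N | ∃ i j : Fin N, i ≠ j ∧ ∃ n : Fin 3 → ℤ,
                  a - ℓ < ‖X i - X j - latticeVec L n‖ ∧ ‖X i - X j - latticeVec L n‖ ≤ a} ∩ cellN N L,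
                  (‖Ψ X‖₊ : ℝ≥0∞) ^ 2) +
            ENNReal.ofReal (C * ℓ ^ 2) *
              ∫⁻ X in {X : Config N | ∃ i j : Fin N, i ≠ j ∧ ∃ n : Fin 3 → ℤ,
                  a - ℓ < ‖X i - X j - latticeVec L n‖ ∧ ‖X i - X j - latticeVec L n‖ < a + ℓ} ∩ cellN N L,
                  kineticDensity Ψ X)
    (hPM : ∀ v : ℝ → ℝ≥0∞, IsRepulsiveFiniteRange v → (∃ M : ℝ≥0∞, M ≠ ⊤ ∧ ∀ r, v r ≤ M) →
      ∀ (n : ℕ) (L : ℝ), 0 < L → ∃ Ψ : PeriodicTrialState (n + 1) L,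
        periodicEnergy v Ψ = periodicGroundStateEnergy v (n + 1) L ∧ periodicEnergy v Ψ ≠ ⊤ ∧
        (∀ X, Ψ.ψ X = (‖Ψ.ψ X‖ : ℂ)) ∧ (∀ X, Ψ.ψ X ≠ 0)) :
    ∀ (v : ℝ → ℝ≥0∞) (a : ℝ) (M : ℝ≥0∞), IsRepulsiveFiniteRange v → 0 < a →
      (∀ r, 0 ≤ r → r < a → v r = ⊤) → M ≠ ⊤ → (∀ r, a < r → v r ≤ M) →
      ∀ (N : ℕ) (L : ℝ), 4 * a < L → periodicGroundStateEnergy v N L ≠ ⊤ →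
      ∀ ε : ℝ, 0 < ε → ∃ n₀ : ℕ, ∀ n : ℕ, n₀ ≤ n →
        periodicGroundStateEnergy v N L ≤
          periodicGroundStateEnergy (fun r => min (v r) (n : ℝ≥0∞)) N L + ENNReal.ofReal ε := by
  intro v a M hv ha hcore hMtop hM N L h4a hB ε hε
  have hL : 0 < L := by linarith
  -- no pairs
  rcases Nat.eq_zero_or_pos N with hN0 | hNpos
  · subst hN0
    exact ⟨0, fun n _ => by
      rw [periodicGroundStateEnergy_congr_of_isEmpty v (fun r => min (v r) (n : ℝ≥0∞)) L]
      exact le_self_add⟩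
  obtain ⟨k, rfl⟩ : ∃ k, N = k + 1 := ⟨N - 1, by omega⟩
  -- positive minimisers of all truncations, their energies below `B = E₀(v)`
  choose Ψ hΨE hΨfin _hΨreal _hΨne using fun n : ℕ =>
    hPM (fun r => min (v r) (n : ℝ≥0∞)) (isRepulsiveFiniteRange_min hv n) (min_bounded v n) k L hL
  have hEn_le : ∀ n : ℕ, periodicGroundStateEnergy (fun r => min (v r) (n : ℝ≥0∞)) (k + 1) L ≤
      periodicGroundStateEnergy v (k + 1) L := fun n =>
    periodicGroundStateEnergy_mono_of_le (fun r => min_le_left _ _)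
  have hΨB : ∀ n : ℕ, periodicEnergy (fun r => min (v r) (n : ℝ≥0∞)) (Ψ n) ≤
      periodicGroundStateEnergy v (k + 1) L := fun n => (hΨE n).le.trans (hEn_le n)
  -- the Rellich subsequence with tight kinetic energy
  obtain ⟨φ, hφ, hT⟩ := htight v hv.1 (k + 1) L hL _ hB Ψ hΨE hΨB
  -- the layers, shrinking to the null wall
  set S : ℕ → Set (Config (k + 1)) := fun kk => {X : Config (k + 1) | ∃ i j : Fin (k + 1), i ≠ j ∧
      ∃ n : Fin 3 → ℤ, a - 1 / ((kk : ℝ) + 1) < ‖X i - X j - latticeVec L n‖ ∧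
        ‖X i - X j - latticeVec L n‖ < a + 1 / ((kk : ℝ) + 1)} with hSdef
  have hSm : ∀ kk, MeasurableSet (S kk) := fun kk =>
    measurableSet_pairImage (S := Set.Ioo (a - 1 / ((kk : ℝ) + 1)) (a + 1 / ((kk : ℝ) + 1))) L
      measurableSet_Ioo
  have hSanti : Antitone S := by
    intro k₁ k₂ hk X hX
    obtain ⟨i, j, hij, n, h1, h2⟩ := hX
    have hmono : (1 : ℝ) / ((k₂ : ℝ) + 1) ≤ 1 / ((k₁ : ℝ) + 1) :=
      one_div_le_one_div_of_le (by positivity) (by exact_mod_cast Nat.succ_le_succ hk)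
    exact ⟨i, j, hij, n, by linarith, by linarith⟩
  have hSnull : volume ((⋂ kk, S kk) ∩ cellN (k + 1) L) = 0 := by
    refine measure_mono_null Set.inter_subset_left ?_
    rw [hSdef, iInter_layer_eq_wall hL a]
    exact volume_wall_eq_zero (k + 1) L a
  have hT' := hT S hSm hSanti hSnull
  -- constants of the cut-off and of the shell bound
  obtain ⟨Cχ, hCχ0, hcutℓ⟩ := hcut (k + 1) L a hL ha
  obtain ⟨Cs, hCs0, hshellℓ⟩ := hshell (k + 1) L a hL ha h4a
  -- the parameters `θ`, `ε₁`
  set E : ℝ := (periodicGroundStateEnergy v (k + 1) L).toReal with hEdef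
  have hE : 0 ≤ E := ENNReal.toReal_nonneg
  have hE1 : (E + 1) ≠ 0 := by positivity
  set θ : ℝ := ε / (6 * (E + 1)) with hθdef
  have hθ : 0 < θ := by positivity
  have hθε : θ * (E + 1) * 6 ≤ ε := by
    have : θ * (E + 1) * 6 = ε := by rw [hθdef]; field_simp
    exact this.le
  have hθ1 : (1 + θ) ≠ 0 := by positivity
  set ε₁ : ℝ := min (ε / (6 * (Cs + 1) * (E + 1) * a ^ 2)) (ε * θ / (6 * (Cχ * Cs + 1) * (1 + θ)))
    with hε₁def
  have hε₁ : 0 < ε₁ := lt_min (by positivity) (by positivity)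
  have hε₁a : ε₁ * (Cs + 1) * (E + 1) * a ^ 2 * 6 ≤ ε := by
    have h := min_le_left (ε / (6 * (Cs + 1) * (E + 1) * a ^ 2)) (ε * θ / (6 * (Cχ * Cs + 1) * (1 + θ)))
    rw [← hε₁def, le_div_iff₀ (by positivity)] at h
    calc ε₁ * (Cs + 1) * (E + 1) * a ^ 2 * 6 = ε₁ * (6 * (Cs + 1) * (E + 1) * a ^ 2) := by ring
      _ ≤ ε := h
  have hε₁b : ε₁ * (Cχ * Cs + 1) * (1 + θ) * 6 ≤ ε * θ := by
    have h := min_le_right (ε / (6 * (Cs + 1) * (E + 1) * a ^ 2)) (ε * θ / (6 * (Cχ * Cs + 1) * (1 + θ)))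
    rw [← hε₁def, le_div_iff₀ (by positivity)] at h
    calc ε₁ * (Cχ * Cs + 1) * (1 + θ) * 6 = ε₁ * (6 * (Cχ * Cs + 1) * (1 + θ)) := by ring
      _ ≤ ε * θ := h
  -- the layer index `k₀`, the subsequence index `i₀`, the shell width `ℓ`, the cut-off `χ`
  obtain ⟨k₀, i₀, hki⟩ := hT' ε₁ hε₁
  set ℓ : ℝ := min a (1 / ((k₀ : ℝ) + 1)) with hℓdef
  have hℓ : 0 < ℓ := lt_min ha (by positivity)
  have hℓa : ℓ ≤ a := min_le_left _ _
  have hℓk : ℓ ≤ 1 / ((k₀ : ℝ) + 1) := min_le_right _ _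
  obtain ⟨χ, hχ1, hχper, hχsymm, hχ01, hχ0, hχfar1, hχC, hχfar⟩ := hcutℓ ℓ hℓ hℓa
  -- the truncation level `m = φ i`
  set R₁ : ℝ := (1 + Cs) * (E ^ 2 + 1) * 6 / ε with hR₁
  set R₂ : ℝ := (1 + θ) * Cχ * Cs * (E + 1) * 6 / (ε * θ * ℓ ^ 2) with hR₂
  set i : ℕ := max i₀ (⌈max M.toReal (max R₁ R₂)⌉₊ + 1) with hidef
  have hi₀ : i₀ ≤ i := le_max_left _ _
  have hiR : max M.toReal (max R₁ R₂) < (i : ℝ) := by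
    have h1 : max M.toReal (max R₁ R₂) ≤ (⌈max M.toReal (max R₁ R₂)⌉₊ : ℝ) := Nat.le_ceil _
    have h2 : ((⌈max M.toReal (max R₁ R₂)⌉₊ + 1 : ℕ) : ℝ) ≤ (i : ℝ) := by exact_mod_cast le_max_right _ _
    push_cast at h2
    linarith
  have him : (i : ℝ) ≤ (φ i : ℝ) := by exact_mod_cast hφ.le_apply
  have hMR := le_max_left M.toReal (max R₁ R₂)
  have hR₁R := (le_max_left R₁ R₂).trans (le_max_right M.toReal (max R₁ R₂))
  have hR₂R := (le_max_right R₁ R₂).trans (le_max_right M.toReal (max R₁ R₂))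
  have hmpos : (0 : ℝ) < (φ i : ℝ) := by
    have : (0 : ℝ) ≤ M.toReal := ENNReal.toReal_nonneg
    linarith
  have hMm : M ≤ ((φ i : ℕ) : ℝ≥0∞) := by
    have h : M.toReal ≤ ((φ i : ℕ) : ℝ) := by linarith
    calc M = ENNReal.ofReal M.toReal := (ENNReal.ofReal_toReal hMtop).symm
      _ ≤ ENNReal.ofReal ((φ i : ℕ) : ℝ) := ENNReal.ofReal_le_ofReal h
      _ = ((φ i : ℕ) : ℝ≥0∞) := ENNReal.ofReal_natCast _
  have hm1 : (1 + Cs) * (E ^ 2 + 1) * 6 ≤ ε * (φ i : ℝ) := by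
    have h : R₁ ≤ (φ i : ℝ) := by linarith
    rw [hR₁, div_le_iff₀ hε] at h
    linarith
  have hm2 : (1 + θ) * Cχ * Cs * (E + 1) * 6 ≤ ε * θ * ℓ ^ 2 * (φ i : ℝ) := by
    have h : R₂ ≤ (φ i : ℝ) := by linarith
    rw [hR₂, div_le_iff₀ (by positivity)] at h
    linarith
  -- the cut state `u = χ Ψ_m`, `Ψ_m` the positive minimiser of the `m`-th truncation
  have hχc1 : ContDiff ℝ 1 (fun Y : Config (k + 1) => (χ Y : ℂ)) := Complex.ofRealCLM.contDiff.comp hχ1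
  have hu1 : ContDiff ℝ 1 (fun Y : Config (k + 1) => (χ Y : ℂ) * (Ψ (φ i)).ψ Y) :=
    hχc1.mul (Ψ (φ i)).contDiff
  have huper : ∀ (X : Config (k + 1)) (i' : Fin (k + 1)) (k' : Fin 3),
      (fun Y : Config (k + 1) => (χ Y : ℂ) * (Ψ (φ i)).ψ Y) (X + Pi.single i' (EuclideanSpace.single k' L)) =
        (fun Y : Config (k + 1) => (χ Y : ℂ) * (Ψ (φ i)).ψ Y) X := fun X i' k' => by
    simp only [hχper X i' k', (Ψ (φ i)).periodic X i' k']
  have husymm : ∀ (σ : Equiv.Perm (Fin (k + 1))) (X : Config (k + 1)),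
      (fun Y : Config (k + 1) => (χ Y : ℂ) * (Ψ (φ i)).ψ Y) (X ∘ σ) =
        (fun Y : Config (k + 1) => (χ Y : ℂ) * (Ψ (φ i)).ψ Y) X := fun σ X => by
    simp only [hχsymm σ X, (Ψ (φ i)).symm σ X]
  -- the `ℝ≥0∞` facts
  have h4E := cutState_form_le (N := k + 1) (L := L) hv.1 hM hMm (Ψ (φ i)) hχ1 hχ01 hχ0 hχC hχfar hθ
  have h2E := (one_le_mass_cutState_add (N := k + 1) (L := L) (Ψ (φ i)) hχfar1).trans
    (add_le_add_left (add_le_add_right (setLIntegral_hardSet_le_open (k + 1) L a _) _) _)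
  have hμ1 := mass_cutState_le_one (N := k + 1) (L := L) (Ψ (φ i)) hχ01
  have hμtop : ∫⁻ X in cellN (k + 1) L, ((‖(χ X : ℂ) * (Ψ (φ i)).ψ X‖₊ : ℝ≥0∞)) ^ 2 ≠ ⊤ :=
    ne_top_of_le_ne_top ENNReal.one_ne_top hμ1
  have h1E := GradientCauchy.groundStateEnergy_mul_mass_le_form (N := k + 1) (L := L) v hu1 huper husymm hμtop
  have hcoreE := mul_coreMass_le_energy (N := k + 1) (L := L) hcore (φ i) (Ψ (φ i))
  have hmK1 : ∫⁻ X in {X : Config (k + 1) | ∃ i j : Fin (k + 1), i ≠ j ∧ ∃ n : Fin 3 → ℤ,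
        ‖X i - X j - latticeVec L n‖ < a} ∩ cellN (k + 1) L, ((‖(Ψ (φ i)).ψ X‖₊ : ℝ≥0∞)) ^ 2 ≤ 1 :=
    (lintegral_mono_set Set.inter_subset_right).trans (Ψ (φ i)).norm_eq.le
  have hmO1 : ∫⁻ X in {X : Config (k + 1) | ∃ i j : Fin (k + 1), i ≠ j ∧ ∃ n : Fin 3 → ℤ,
        a < ‖X i - X j - latticeVec L n‖ ∧ ‖X i - X j - latticeVec L n‖ < a + ℓ} ∩ cellN (k + 1) L,
        ((‖(Ψ (φ i)).ψ X‖₊ : ℝ≥0∞)) ^ 2 ≤ 1 :=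
    (lintegral_mono_set Set.inter_subset_right).trans (Ψ (φ i)).norm_eq.le
  have hinnerE : ∫⁻ X in {X : Config (k + 1) | ∃ i j : Fin (k + 1), i ≠ j ∧ ∃ n : Fin 3 → ℤ,
        a - ℓ < ‖X i - X j - latticeVec L n‖ ∧ ‖X i - X j - latticeVec L n‖ ≤ a} ∩ cellN (k + 1) L,
        ((‖(Ψ (φ i)).ψ X‖₊ : ℝ≥0∞)) ^ 2 ≤
      ∫⁻ X in {X : Config (k + 1) | ∃ i j : Fin (k + 1), i ≠ j ∧ ∃ n : Fin 3 → ℤ,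
        ‖X i - X j - latticeVec L n‖ < a} ∩ cellN (k + 1) L, ((‖(Ψ (φ i)).ψ X‖₊ : ℝ≥0∞)) ^ 2 := by
    refine le_trans (lintegral_mono_set (Set.inter_subset_inter_left _ ?_))
      (setLIntegral_hardSet_le_open (k + 1) L a _)
    rintro X ⟨i', j', hij, n, -, h2⟩
    exact ⟨i', j', hij, n, h2⟩
  have hshellE := hshellℓ ℓ hℓ hℓa (Ψ (φ i)).ψ (Ψ (φ i)).contDiff (Ψ (φ i)).periodic
  have hKlE : ∫⁻ X in {X : Config (k + 1) | ∃ i j : Fin (k + 1), i ≠ j ∧ ∃ n : Fin 3 → ℤ,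
        a - ℓ < ‖X i - X j - latticeVec L n‖ ∧ ‖X i - X j - latticeVec L n‖ < a + ℓ} ∩ cellN (k + 1) L,
        kineticDensity (Ψ (φ i)).ψ X ≤ ENNReal.ofReal ε₁ := by
    refine le_trans (lintegral_mono_set (Set.inter_subset_inter_left _ ?_)) (hki k₀ i le_rfl hi₀)
    rintro X ⟨i', j', hij, n, h1, h2⟩
    exact ⟨i', j', hij, n, by linarith, by linarith⟩
  have hEmB : periodicEnergy (fun r => min (v r) ((φ i : ℕ) : ℝ≥0∞)) (Ψ (φ i)) ≤
      periodicGroundStateEnergy v (k + 1) L := hΨB (φ i)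
  -- the bookkeeping
  have key : periodicGroundStateEnergy v (k + 1) L ≤
      periodicEnergy (fun r => min (v r) ((φ i : ℕ) : ℝ≥0∞)) (Ψ (φ i)) + ENNReal.ofReal ε :=
    bookkeeping_ennreal hB hEmB hθ hCs0 hCχ0 hℓ hℓa hmpos hε hε₁ h1E h2E hμ1 hmK1 hmO1 h4E hcoreE hinnerE
      hshellE hKlE hθε hε₁a hε₁b hm1 hm2
  rw [hΨE (φ i)] at key
  -- monotonicity in the truncation level
  refine ⟨φ i, fun n hn => key.trans ?_⟩
  have hmn : ((φ i : ℕ) : ℝ≥0∞) ≤ (n : ℝ≥0∞) := by exact_mod_cast hn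
  exact add_le_add_left (periodicGroundStateEnergy_mono_of_le fun r => min_le_min_left (v r) hmn) _

end AlphaPhys

/-- **(α'_phys), closed modulo the three classical inputs** — registered composition node of the line
`third-law-current-floor`: the pair cut-off (`stub_pairCutoffExists`), the kinetic tightness of truncation minimisers
(`stub_truncationMinimisersKineticTightness`) and the pair-shell mass bound (`stub_pairShellMassBoundV2`) imply the
truncation energy convergence from below at hard-core-type potentials (`v = ⊤` on `[0,a)`, `v ≤ M < ⊤` on `(a,∞)`, so in
particular `hardCorePotential a`), for every `N`, every `L > 4a` of finite energy and every `ε > 0`; the positive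
minimisers of the bounded class are supplied by `stub_boundedPositiveMinimiserHolds`. [folklore] -/
theorem stub_truncationEnergyConvergencePhys_of :
    (∀ (N : ℕ) (L a : ℝ), 0 < L → 0 < a → ∃ C : ℝ, 0 ≤ C ∧ ∀ ℓ : ℝ, 0 < ℓ → ℓ ≤ a →
      ∃ χ : Config N → ℝ, ContDiff ℝ 1 χ ∧
        (∀ (X : Config N) (i : Fin N) (k : Fin 3),
          χ (X + Pi.single i (EuclideanSpace.single k L)) = χ X) ∧
        (∀ (σ : Equiv.Perm (Fin N)) (X : Config N), χ (X ∘ σ) = χ X) ∧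
        (∀ X, 0 ≤ χ X ∧ χ X ≤ 1) ∧
        (∀ X : Config N, (∃ i j : Fin N, i ≠ j ∧ ∃ n : Fin 3 → ℤ, ‖X i - X j - latticeVec L n‖ ≤ a) →
          χ X = 0) ∧
        (∀ X : Config N, (∀ i j : Fin N, i ≠ j → ∀ n : Fin 3 → ℤ, a + ℓ ≤ ‖X i - X j - latticeVec L n‖) →
          χ X = 1) ∧
        (∀ X : Config N, kineticDensity (fun Y => (χ Y : ℂ)) X ≤ ENNReal.ofReal (C / ℓ ^ 2)) ∧
        (∀ X : Config N, (∀ i j : Fin N, i ≠ j → ∀ n : Fin 3 → ℤ,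
            ‖X i - X j - latticeVec L n‖ ≤ a ∨ a + ℓ ≤ ‖X i - X j - latticeVec L n‖) →
          kineticDensity (fun Y => (χ Y : ℂ)) X = 0)) →
    (∀ (v : ℝ → ℝ≥0∞), Measurable v → ∀ (N : ℕ) (L : ℝ), 0 < L → ∀ B : ℝ≥0∞, B ≠ ⊤ →
      ∀ Ψ : ℕ → PeriodicTrialState N L,
        (∀ n : ℕ, periodicEnergy (fun r => min (v r) (n : ℝ≥0∞)) (Ψ n) =
          periodicGroundStateEnergy (fun r => min (v r) (n : ℝ≥0∞)) N L) →
        (∀ n : ℕ, periodicEnergy (fun r => min (v r) (n : ℝ≥0∞)) (Ψ n) ≤ B) →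
        ∃ φ : ℕ → ℕ, StrictMono φ ∧
          ∀ S : ℕ → Set (Config N), (∀ k, MeasurableSet (S k)) → Antitone S →
            volume ((⋂ k, S k) ∩ cellN N L) = 0 →
            ∀ ε : ℝ, 0 < ε → ∃ k₀ i₀ : ℕ, ∀ k i : ℕ, k₀ ≤ k → i₀ ≤ i →
              ∫⁻ X in S k ∩ cellN N L, kineticDensity (Ψ (φ i)).ψ X ≤ ENNReal.ofReal ε) →
    (∀ (N : ℕ) (L a : ℝ), 0 < L → 0 < a → 4 * a < L → ∃ C : ℝ, 0 ≤ C ∧ ∀ ℓ : ℝ, 0 < ℓ → ℓ ≤ a →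
      ∀ Ψ : Config N → ℂ, ContDiff ℝ 1 Ψ →
        (∀ (X : Config N) (i : Fin N) (k : Fin 3), Ψ (X + Pi.single i (EuclideanSpace.single k L)) = Ψ X) →
        ∫⁻ X in {X : Config N | ∃ i j : Fin N, i ≠ j ∧ ∃ n : Fin 3 → ℤ,
            a < ‖X i - X j - latticeVec L n‖ ∧ ‖X i - X j - latticeVec L n‖ < a + ℓ} ∩ cellN N L,
            (‖Ψ X‖₊ : ℝ≥0∞) ^ 2 ≤
          ENNReal.ofReal C *
              (∫⁻ X in {X : Config N | ∃ i j : Fin N, i ≠ j ∧ ∃ n : Fin 3 → ℤ,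
                  a - ℓ < ‖X i - X j - latticeVec L n‖ ∧ ‖X i - X j - latticeVec L n‖ ≤ a} ∩ cellN N L,
                  (‖Ψ X‖₊ : ℝ≥0∞) ^ 2) +
            ENNReal.ofReal (C * ℓ ^ 2) *
              ∫⁻ X in {X : Config N | ∃ i j : Fin N, i ≠ j ∧ ∃ n : Fin 3 → ℤ,
                  a - ℓ < ‖X i - X j - latticeVec L n‖ ∧ ‖X i - X j - latticeVec L n‖ < a + ℓ} ∩ cellN N L,
                  kineticDensity Ψ X) →
    ∀ (v : ℝ → ℝ≥0∞) (a : ℝ) (M : ℝ≥0∞), IsRepulsiveFiniteRange v → 0 < a →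
      (∀ r, 0 ≤ r → r < a → v r = ⊤) → M ≠ ⊤ → (∀ r, a < r → v r ≤ M) →
      ∀ (N : ℕ) (L : ℝ), 4 * a < L → periodicGroundStateEnergy v N L ≠ ⊤ →
      ∀ ε : ℝ, 0 < ε → ∃ n₀ : ℕ, ∀ n : ℕ, n₀ ≤ n →
        periodicGroundStateEnergy v N L ≤
          periodicGroundStateEnergy (fun r => min (v r) (n : ℝ≥0∞)) N L + ENNReal.ofReal ε :=
  fun hcut htight hshell => AlphaPhys.alphaPhys_of hcut htight hshell stub_boundedPositiveMinimiserHolds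

end Summit.AtomisticToContinuum.BoseEinsteinCondensation.Cruxes.HardCoreExtension.ThirdLawCurrentFloor

end
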